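import Summits.BirchSwinnertonDyer.Rank1Residual.AdditivePotMult.QuadraticBaseChangeOddTamagawaSemistable
import Summits.BirchSwinnertonDyer.Rank1Residual.AdditivePotMult.QuadraticTwistTamagawaMultiplicativeTwo
import HarnessLib

/-!
# The odd Tamagawa identity on S₁ without the proviso at the multiplicative place `2`
# (row T-MIL-ODD, FILE C-3f; seat n1011-p01 GEN 6)

HONEST FRAMING (cell `b2b-bsdres`, run/shared/lean/b2b/bsd-rank1-residual/, verbatim in every
file): the goal of the cell is to DELETE the COMBINATION-SHAPED residual classes of the
Birch–Swinnerton-Dyer formula for ALL analytic-rank `≤ 1` elliptic curves over `ℚ` — "full BSD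
formula for every rank `≤ 1` curve in class `C`" assembled STRICTLY from published theorems — so
that the rank-`≤ 1` remainder becomes exactly the CONSTRUCTION-SHAPED classes, which are TYPED
(missing-input `Prop`s), NOT attempted. This is not "finishing BSD". Sub-classes X3♯(M) / X4(M)
(additive, potentially multiplicative prime; base-change-and-descend): a RESEARCH ROUTE; they stay
CONSTRUCTION-SHAPED; nothing is booked by this file; no mark / label moved. THEOREMS ONLY: no
definition, no named fact, no `sorry`.

## What (row T-MIL-ODD, `cells/n1011/skel/T-MIL-ODD.md` §6)

FILE C-3d (`padicValRat_norm_mul_tamagawaProduct_eq_of_semistable`) proved the odd Tamagawa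
identity of Milne's quadratic BSD quotient on the population S₁ with the proviso "`W`
multiplicative at `2` only if `d_K ≡ 1 (mod 8)`". FILE A-2two
(`padicValNat_localTamagawaNumber_add_quadraticTwist_two_of_emod_eight_eq_five`: the unit twist
`d ≡ 5 (mod 8)` at a multiplicative `2` flips the splitting of the node — the tree's
Artin–Schreier twist model) supplies the missing twist-side entry at an INERT multiplicative `2`,
and this file removes the proviso:

* `sum_fibre_padicValNat_localTamagawaNumber_of_mult_of_inert_two` — (T) at the inert
  multiplicative place over `2` (`d_K ≡ 5 mod 8`);
* `sum_fibre_padicValNat_localTamagawaNumber_of_semistable'`,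
  `sum_fibre_inertiaDeg_mul_ord_u_eq_of_semistable'` — (T) and (D) from the LOCAL population
  hypothesis at the place (good, or multiplicative, or `ℓ ∣ d_K` with `W_d` multiplicative);
* `padicValRat_norm_mul_tamagawaProduct_eq_of_semistable'` — **THE END without proviso**: for
  `W/ℚ` globally minimal elliptic, `K` quadratic with `d_K` odd squarefree, globally minimal models
  `W_d = C_d • W^{(d_K)}`, `W' = C' • W_K`, and `hS : ∀ v`, `W` good at `v` ∨ `W` multiplicative at
  `v` ∨ (`ℓ_v ∣ d_K` ∧ `W_d` multiplicative at `v`), every odd `p`: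
  `v_p(|N_{K/ℚ}(C'.u)| · ∏_w c_w(W')) = v_p(|C_d.u| · ∏_v c_v(W) · ∏_v c_v(W_d))`.

So the population is now: every bad place of `W` is multiplicative or a potentially multiplicative
prime ramified in `K` — for `K = ℚ(√p*)` exactly the X3♯(M)/X4(M) curves of conductor `p²·N'`,
`N'` squarefree prime to `p`, with no condition at `2`. HONEST LIMITS as in FILE C-3d otherwise
(additive places of `W` unramified in `K`, even `d_K`, IV/IV* at `p = 3` not covered); closes no
class; moves no mark; no consumer binder changed.
-/

noncomputable section

open scoped Classical NumberField

open WeierstrassCurve NumberField IsDedekindDomain Rat.HeightOneSpectrum WithZero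
  Literature.NumberTheory.EllipticCurves
  Summit.BirchSwinnertonDyer.Rank1Residual.Additive

namespace Summit.BirchSwinnertonDyer.Rank1Residual.AdditivePotMult

section InertTwo

variable (W : WeierstrassCurve ℚ) [W.IsElliptic] [W.IsGloballyMinimal] {K : Type} [Field K]
  [NumberField K] (Wd : WeierstrassCurve ℚ) (p : ℕ) [hp : Fact p.Prime] (v : HeightOneSpectrum (𝓞 ℚ))

/-- **(T) at the INERT multiplicative place over `2`** (`d_K ≡ 5 (mod 8)`, single place `w` with
`e = 1`, `f = 2`, `W/ℚ` globally minimal multiplicative at `v ∣ 2`, `p` odd): `v_p(c_w(W_K)) = v_p(n)`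
(FILE C-3b, no parity hypothesis on the `K`-side) `= v_p(c_v(W)) + v_p(c_v(W_d))` (FILE A-2two: exactly
one of `W`, `W^{(d_K)}` is split at `2`). Kramer 1981 §2 Props. 2, 4–5.
[cite: SilvermanATAEC1994, IV.9.4 Step 2 and Cor. IV.9.2(d)] -/
theorem sum_fibre_padicValNat_localTamagawaNumber_of_mult_of_inert_two
    {Cd : VariableChange ℚ} (hWd : Cd • W.quadraticTwist (NumberField.discr K : ℚ) = Wd)
    (hd8 : NumberField.discr K % 8 = 5) (hv2 : (primesEquiv v : ℕ) = 2)
    (hmult : W.HasMultiplicativeReductionAt v) {w : HeightOneSpectrum (𝓞 K)}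
    (hset : {w' : HeightOneSpectrum (𝓞 K) | w'.under (𝓞 ℚ) = v} = {w})
    (he : w.asIdeal.ramificationIdx (𝓞 ℚ) = 1) (hf : w.asIdeal.inertiaDeg (𝓞 ℚ) = 2) (hp2 : p ≠ 2) :
    ∑ w ∈ (HeightOneSpectrum.finite_setOf_under_eq_of_numberField (K := K) v).toFinset,
        padicValNat p (((W.baseChange K).baseChange (w.adicCompletion K)).localTamagawaNumber
          (w.adicCompletionIntegers K)) =
      padicValNat p ((W.baseChange (v.adicCompletion ℚ)).localTamagawaNumber
          (v.adicCompletionIntegers ℚ)) +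
        padicValNat p ((Wd.baseChange (v.adicCompletion ℚ)).localTamagawaNumber
          (v.adicCompletionIntegers ℚ)) := by
  have hw : w.under (𝓞 ℚ) = v := under_eq_of_fibre_eq_singleton hset
  have hd : (NumberField.discr K : ℚ) ≠ 0 := by exact_mod_cast NumberField.discr_ne_zero K
  haveI := W.isElliptic_quadraticTwist hd
  rw [toFinset_eq_singleton_of_fibre hset, Finset.sum_singleton,
    padicValNat_localTamagawaNumber_baseChange_of_mult_of_inert W p hmult hw he hf,
    localTamagawaNumber_eq_of_variableChange_eq hWd v]
  exact (padicValNat_localTamagawaNumber_add_quadraticTwist_two_of_emod_eight_eq_five v W hv2 hd8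
    hmult p hp2).symm

end InertTwo

section End

variable (W : WeierstrassCurve ℚ) [W.IsElliptic] [W.IsGloballyMinimal]
  (K : Type) [Field K] [NumberField K] (Wd : WeierstrassCurve ℚ) [Wd.IsElliptic] [Wd.IsGloballyMinimal]
  (W' : WeierstrassCurve K) [W'.IsGloballyMinimal]

/-- **(T) at a place `v` from the LOCAL population hypothesis at `v`** (`W` good at `v`, or
multiplicative at `v` — ANY residue characteristic, including an inert `2` via
`sum_fibre_padicValNat_localTamagawaNumber_of_mult_of_inert_two` —, or `ℓ_v ∣ d_K` with `W_d`
multiplicative at `v`), `d_K` odd squarefree, `p` odd: `Σ_{w ∣ v} v_p(c_w(W_K)) = v_p(c_v(W)) +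
v_p(c_v(W_d))`. Same case analysis as FILE C-3d's `…_of_semistable`.
[cite: Milne1972ArithmeticAV, §1 Thm. 1 and §2 (through DokchitserDokchitserAnnals2010, §2.1, proof of Thm. 8)] -/
theorem sum_fibre_padicValNat_localTamagawaNumber_of_semistable' (h2 : Module.finrank ℚ K = 2)
    (hdodd : Odd (NumberField.discr K)) (hdsq : Squarefree (NumberField.discr K))
    {Cd : VariableChange ℚ} (hWd : Cd • W.quadraticTwist (NumberField.discr K : ℚ) = Wd)
    (p : ℕ) [Fact p.Prime] (hp2 : p ≠ 2) (v : HeightOneSpectrum (𝓞 ℚ))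
    (hSv : W.HasGoodReductionAt v ∨ W.HasMultiplicativeReductionAt v ∨
      (((primesEquiv v : ℕ) : ℤ) ∣ NumberField.discr K ∧ Wd.HasMultiplicativeReductionAt v)) :
    ∑ w ∈ (HeightOneSpectrum.finite_setOf_under_eq_of_numberField (K := K) v).toFinset,
        padicValNat p (((W.baseChange K).baseChange (w.adicCompletion K)).localTamagawaNumber
          (w.adicCompletionIntegers K)) =
      padicValNat p ((W.baseChange (v.adicCompletion ℚ)).localTamagawaNumber
          (v.adicCompletionIntegers ℚ)) +
        padicValNat p ((Wd.baseChange (v.adicCompletion ℚ)).localTamagawaNumber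
          (v.adicCompletionIntegers ℚ)) := by
  set d : ℤ := NumberField.discr K with hddef
  have hd0 : d ≠ 0 := NumberField.discr_ne_zero K
  have hd4 : d % 4 = 1 := by
    rcases Literature.NumberTheory.QuadraticFields.Quadratic.discr_emod_four h2 with h | h
    · exfalso
      obtain ⟨k, hk⟩ := hdodd
      omega
    · exact h
  have hℓ : ((primesEquiv v : ℕ)).Prime := (primesEquiv v).2
  have hd2 : ¬ ((primesEquiv v : ℕ) : ℤ) ^ 2 ∣ d := not_sq_dvd_of_squarefree hdsq _ hℓ
  rcases placesOver_trichotomy_of_finrank_eq_two K h2 v with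
    ⟨w₁, w₂, hne, hset, hef⟩ | ⟨w, hset, he, hf⟩ | ⟨w, hset, he, hf⟩
  · exact sum_fibre_padicValNat_localTamagawaNumber_of_split W Wd p v h2 hWd hne hset hef
  · have hnd := not_dvd_discr_of_fibre_eq_singleton K v hset he
    rcases hSv with hgood | hmult | ⟨hdvd, -⟩
    · rw [sum_fibre_padicValNat_localTamagawaNumber_eq_zero_of_good W p v hgood,
        padicValNat_localTamagawaNumber_eq_zero_of_good W p v hgood, zero_add]
      by_cases hv2 : (primesEquiv v : ℕ) = 2
      · rw [localTamagawaNumber_twist_eq_one_of_good_of_emod_four W v hd4 hnd hgood hWd,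
          padicValNat_one_right]
      · exact (padicValNat_localTamagawaNumber_twist_eq_zero_of_good_of_odd W Wd p v hv2 hd0 hd2 hWd
          hgood hp2).symm
    · by_cases hv2 : (primesEquiv v : ℕ) = 2
      · -- the inert multiplicative place over `2`: `d_K ≡ 5 (mod 8)`
        have hd8 : d % 8 = 5 := by
          have h81 : d % 8 ≠ 1 := by
            intro h8
            have hsplit :=
              (Literature.NumberTheory.QuadraticFields.Quadratic.ncard_primesOver_two_eq_two_iff h2).mpr h8
            have h1 := ncard_primesOver_eq_one_of_fibre_singleton K v hset
            rw [hv2] at h1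
            simp only [Nat.cast_ofNat] at h1
            rw [h1] at hsplit
            exact absurd hsplit (by decide)
          omega
        exact sum_fibre_padicValNat_localTamagawaNumber_of_mult_of_inert_two W Wd p v hWd hd8 hv2
          hmult hset he hf hp2
      · exact sum_fibre_padicValNat_localTamagawaNumber_of_mult_of_inert W Wd p v h2 hWd hv2 hmult
          hset he hf hp2
    · exact absurd hdvd hnd
  · have hw : w.under (𝓞 ℚ) = v := under_eq_of_fibre_eq_singleton hset
    have hdvd : ((primesEquiv v : ℕ) : ℤ) ∣ d := natCast_dvd_discr_of_ramificationIdx_eq_two K v hw he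
    have hv2 : (primesEquiv v : ℕ) ≠ 2 := by
      intro h2'
      rw [h2'] at hdvd
      obtain ⟨k, hk⟩ := hdodd
      omega
    rcases hSv with hgood | hmult | ⟨-, hmultd⟩
    · rw [sum_fibre_padicValNat_localTamagawaNumber_eq_zero_of_good W p v hgood,
        padicValNat_localTamagawaNumber_eq_zero_of_good W p v hgood, zero_add]
      exact (padicValNat_localTamagawaNumber_twist_eq_zero_of_good_of_odd W Wd p v hv2 hd0 hd2 hWd
        hgood hp2).symm
    · exact sum_fibre_padicValNat_localTamagawaNumber_of_mult_of_ramified W Wd p v hd2 hWd hv2 hmult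
        hset he hf hdvd hp2
    · exact sum_fibre_padicValNat_localTamagawaNumber_of_potMult_of_ramified W Wd p v h2 hd2 hWd hv2
        hmultd hset he hf hdvd hp2

/-- **(D) the `δ`-identity at an odd place `v₀` from the LOCAL population hypothesis at `v₀`**:
`Σ_{w ∣ v₀} f(w|v₀)·ord_w(C'.u) = ord_{v₀}(C_d.u)` (FILE C-3c lemmas; as in FILE C-3d).
[cite: SilvermanAEC2009, VII.1 Prop. 1.3(a)–(b) and VIII.8] -/
theorem sum_fibre_inertiaDeg_mul_ord_u_eq_of_semistable' (h2 : Module.finrank ℚ K = 2)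
    (hdsq : Squarefree (NumberField.discr K))
    {Cd : VariableChange ℚ} (hWd : Cd • W.quadraticTwist (NumberField.discr K : ℚ) = Wd)
    {C' : VariableChange K} (hW' : C' • W.baseChange K = W')
    (v₀ : HeightOneSpectrum (𝓞 ℚ)) (hv₀2 : (primesEquiv v₀ : ℕ) ≠ 2)
    (hS₀ : W.HasGoodReductionAt v₀ ∨ W.HasMultiplicativeReductionAt v₀ ∨
      (((primesEquiv v₀ : ℕ) : ℤ) ∣ NumberField.discr K ∧ Wd.HasMultiplicativeReductionAt v₀)) :
    ∑ w ∈ (HeightOneSpectrum.finite_setOf_under_eq_of_numberField (K := K) v₀).toFinset,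
        (w.asIdeal.inertiaDeg (𝓞 ℚ) : ℤ) * (-log (w.valuation K (C'.u : K))) =
      -log (v₀.valuation ℚ (Cd.u : ℚ)) := by
  set d : ℤ := NumberField.discr K with hddef
  have hd0 : d ≠ 0 := NumberField.discr_ne_zero K
  have hℓ : ((primesEquiv v₀ : ℕ)).Prime := (primesEquiv v₀).2
  have hd2 : ¬ ((primesEquiv v₀ : ℕ) : ℤ) ^ 2 ∣ d := not_sq_dvd_of_squarefree hdsq _ hℓ
  have hmin : ∀ w : HeightOneSpectrum (𝓞 K), W'.IsMinimalAt w := fun w =>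
    IsGloballyMinimal.isMinimal (W := W') w
  rcases placesOver_trichotomy_of_finrank_eq_two K h2 v₀ with
    ⟨w₁, w₂, hne, hset, hef⟩ | ⟨w, hset, he, hf⟩ | ⟨w, hset, he, hf⟩
  · have hw₁ : w₁.under (𝓞 ℚ) = v₀ := by
      have h : w₁ ∈ ({w₁, w₂} : Set (HeightOneSpectrum (𝓞 K))) := Set.mem_insert _ _
      rwa [← hset] at h
    have hw₂ : w₂.under (𝓞 ℚ) = v₀ := by
      have h : w₂ ∈ ({w₁, w₂} : Set (HeightOneSpectrum (𝓞 K))) :=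
        Set.mem_insert_of_mem _ (Set.mem_singleton _)
      rwa [← hset] at h
    obtain ⟨hnd, -⟩ := not_dvd_and_isSquare_discr_of_split v₀ h2 hv₀2 hne hset
    rw [toFinset_eq_pair_of_fibre hset, Finset.sum_pair hne]
    rcases hS₀ with hgood | hmult | ⟨hdvd, -⟩
    · rw [valuation_u_eq_one_of_good W w₁ hw₁ hW' (hmin w₁) hgood,
        valuation_u_eq_one_of_good W w₂ hw₂ hW' (hmin w₂) hgood,
        valuation_u_twist_eq_one_of_not_dvd_of_good W Wd v₀ hv₀2 hd0 hnd hWd hgood, log_one]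
      simp
    · rw [valuation_u_eq_one_of_mult W w₁ hw₁ hW' (hmin w₁) hmult,
        valuation_u_eq_one_of_mult W w₂ hw₂ hW' (hmin w₂) hmult,
        valuation_u_twist_eq_one_of_not_dvd_of_mult W Wd v₀ hv₀2 hd0 hnd hWd hmult, log_one]
      simp
    · exact absurd hdvd hnd
  · have hw : w.under (𝓞 ℚ) = v₀ := under_eq_of_fibre_eq_singleton hset
    have hnd := not_dvd_discr_of_fibre_eq_singleton K v₀ hset he
    rw [toFinset_eq_singleton_of_fibre hset, Finset.sum_singleton]
    rcases hS₀ with hgood | hmult | ⟨hdvd, -⟩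
    · rw [valuation_u_eq_one_of_good W w hw hW' (hmin w) hgood,
        valuation_u_twist_eq_one_of_not_dvd_of_good W Wd v₀ hv₀2 hd0 hnd hWd hgood, log_one]
      simp
    · rw [valuation_u_eq_one_of_mult W w hw hW' (hmin w) hmult,
        valuation_u_twist_eq_one_of_not_dvd_of_mult W Wd v₀ hv₀2 hd0 hnd hWd hmult, log_one]
      simp
    · exact absurd hdvd hnd
  · have hw : w.under (𝓞 ℚ) = v₀ := under_eq_of_fibre_eq_singleton hset
    have hdvd : ((primesEquiv v₀ : ℕ) : ℤ) ∣ d := natCast_dvd_discr_of_ramificationIdx_eq_two K v₀ hw he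
    rw [toFinset_eq_singleton_of_fibre hset, Finset.sum_singleton, hf]
    rcases hS₀ with hgood | hmult | ⟨-, hmultd⟩
    · rw [valuation_u_eq_one_of_good W w hw hW' (hmin w) hgood,
        valuation_u_twist_eq_one_of_dvd_of_good W Wd v₀ hv₀2 hdvd hd2 hWd hgood, log_one]
      simp
    · rw [valuation_u_eq_one_of_mult W w hw hW' (hmin w) hmult,
        valuation_u_twist_eq_one_of_dvd_of_mult W Wd v₀ hv₀2 hdvd hd2 hWd hmult, log_one]
      simp
    · obtain ⟨θ, hθ0, hθ⟩ := exists_sq_eq_discr h2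
      rw [log_valuation_u_eq_neg_one_of_potMult W w Wd hv₀2 hdvd hd2 hWd hmultd hθ0 hθ hw he hW'
          (hmin w),
        log_valuation_u_twist_eq_neg_one_of_potMult W Wd v₀ hv₀2 hdvd hd2 hWd hmultd]
      simp

/-- **THE ODD TAMAGAWA IDENTITY ON S₁, NO PROVISO AT `2` (every odd `p`).** For `W/ℚ` globally
minimal elliptic, `K` quadratic with `d_K` odd squarefree, globally minimal models
`W_d = C_d • W^{(d_K)}`, `W' = C' • W_K`, and `hS`: at every place `W` is good, or multiplicative, or
the place divides `d_K` and `W_d` is multiplicative there; then for every odd prime `p`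
`v_p(|N_{K/ℚ}(C'.u)| · ∏_w c_w(W')) = v_p(|C_d.u| · ∏_v c_v(W) · ∏_v c_v(W_d))` — the body of `hodd`
in the tree's `bsdRHS_baseChange_quadratic_of_padicValRat`, via the assembly schema (FILE C-2) fed
with (T)' and (P) = (T)' + (D)'. Supersedes FILE C-3d's `…_of_semistable` (strictly weaker `hS`).
[cite: Milne1972ArithmeticAV, §1 Thm. 1 and §2 (through DokchitserDokchitserAnnals2010, §2.1, proof of Thm. 8)] -/
theorem padicValRat_norm_mul_tamagawaProduct_eq_of_semistable' (h2 : Module.finrank ℚ K = 2)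
    (hdodd : Odd (NumberField.discr K)) (hdsq : Squarefree (NumberField.discr K))
    {Cd : VariableChange ℚ} (hWd : Cd • W.quadraticTwist (NumberField.discr K : ℚ) = Wd)
    {C' : VariableChange K} (hW' : C' • W.baseChange K = W')
    (hS : ∀ v : HeightOneSpectrum (𝓞 ℚ), W.HasGoodReductionAt v ∨ W.HasMultiplicativeReductionAt v ∨
      (((primesEquiv v : ℕ) : ℤ) ∣ NumberField.discr K ∧ Wd.HasMultiplicativeReductionAt v))
    (p : ℕ) [hp : Fact p.Prime] (hp2 : p ≠ 2) :
    padicValRat p (|Algebra.norm ℚ (C'.u : K)| * W'.tamagawaProduct : ℚ) =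
      padicValRat p (|(Cd.u : ℚ)| * (W.tamagawaProduct * Wd.tamagawaProduct) : ℚ) := by
  set v₀ : HeightOneSpectrum (𝓞 ℚ) := (primesEquiv (R := 𝓞 ℚ)).symm ⟨p, hp.out⟩ with hv₀def
  have hv₀ : (primesEquiv v₀ : ℕ) = p := by
    rw [hv₀def, Equiv.apply_symm_apply]
  have hv₀2 : (primesEquiv v₀ : ℕ) ≠ 2 := by rw [hv₀]; exact hp2
  have hu' : (C'.u : K) ≠ 0 := Units.ne_zero _
  have hud : (Cd.u : ℚ) ≠ 0 := Units.ne_zero _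
  have hT := fun v => sum_fibre_padicValNat_localTamagawaNumber_of_semistable' W K Wd h2 hdodd hdsq
    hWd p hp2 v (hS v)
  have hD := sum_fibre_inertiaDeg_mul_ord_u_eq_of_semistable' W K Wd W' h2 hdsq hWd hW' v₀ hv₀2
    (hS v₀)
  refine padicValRat_norm_mul_tamagawaProduct_eq_of_local_baseChange W Wd W' hW' hu' hud p v₀ hv₀
    (fun v _ => hT v) ?_
  rw [Finset.sum_add_distrib, hD, ← Nat.cast_sum, hT v₀, Nat.cast_add]

end End

end Summit.BirchSwinnertonDyer.Rank1Residual.AdditivePotMult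

end
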